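/-
Copyright: the b2b-balaban T⁴-continuum CRUX team, row NE7b OWNER lineage `t4-ne7b-p1` (gen 143). Project licence.
-/
import Summits.QuantumFields.BalabanUV.T4Continuum.Spine.NE7b.SupWhitenedFourthCumulantTree
import Summits.QuantumFields.BalabanUV.T4Continuum.Spine.NE7b.SupWhitenedVertexMomentLetters
import Summits.QuantumFields.BalabanUV.T4Continuum.Spine.NE7b.SupWhitenedSixthMoment
import Summits.QuantumFields.BalabanUV.T4Continuum.Spine.NE7b.SupWhitenedMixedThirdCumulantRaw

/-!
# THE FOUR-POINT PIECE, SECOND PLACEMENT `κ₄(U′e_x, U″e_ye_z, U′e_t, U′e_s)`: TREE DECAY OVER `{x,y,t,s}` (SCOPING (d14)(2)(iv); (496) with the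
# Hessian-entry observable `G_{yz}` (vector weighted at `y`) in the second slot — pattern (497), EVERY moment discharged under the common letters
# `M₄ = 5(κ₂⁴+κ₃⁴)γ_op²∕(1−λγ_op)²`, `M₂ = (M₄+1)∕2`, `M₆ = 50(κ₂⁶+κ₃⁶)γ_op³∕(1−λγ_op)³`):
#   `|u₄(F_x,G_{yz},F_t,F_s)| ≤ (4K + 3K² + 4M₄ + 4M₆ + 2M₂(M₂+M₄))·Σ_{T} Π_{e∈T} r_e⁻²`   (sixteen labelled spanning trees on `{x,y,t,s}`)
# — UNIFORM IN THE BACKGROUND AND THE VOLUME (row NE7b, node U5c; (496), (497), (466), (465), (505), (506), (565), (469) BY NAME; [folklore])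

Cell `pub-balaban`, sub-cell `t4`, spine estimate NE7b (`T4WeightBudget.RelWeightBound`; the cell's OWN estimate — NOT PRINTED in
[Bałaban 1983–89], NOT PROVED).  Crux-route work under `Spine/NE7b/` by the row OWNER (`t4-ne7b-p1` gen 143, file (573)) under FREEZE
(0)'s crux-prover clause; NOTHING of Bałaban's is named as a Lean object, valued or asserted; no `T4Continuum/Support` leaf typed; no
`def`, no notation (`u₄`, the tree sum and every constant WRITTEN OUT); zero `sorry`.  Imports (BY NAME): the OWNER's (497)
`…SupWhitenedFourthCumulantTree` (`second_le_of_fourth`; through it (496) `fourth_cumulant_tree_bound`, (466), (465), (458), (457), (456)), (565)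
`…SupWhitenedVertexMomentLetters` (`whitened_hessian_obs_sixth_*`; through it (506)), (505) `…SupWhitenedSixthMoment`, (507)
`…SupWhitenedMixedThirdCumulantRaw` (for (469) `hessian_obs_lipVec`).

WHAT IS PROVED ([folklore]): THE END **`whitened_hessian_fourth_cumulant_tree_two`**; toy.

HONEST (what this is NOT).  One placement of the Hessian pair in the four-point piece (entry bound); the row letters (the Hessian pair's second
index summed over its FINITE support, the four sites by (488)'s tree sums) and the FORM of `∂⁵W` are NOT typed here.  Scalar skeleton ((A3),
NC-NE7b-α UNRULED); nothing of Bałaban's asserted.  BY-NAME EFFECT ON THE WALL: NONE.  NE7b NOT PRINTED ∕ NOT PROVED; spine PROVED 0∕9; rung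
(B)+1 — the programme's measures remain FINITE-torus statements; NOT the mass gap, NOT Clay.  HONEST DEPENDENCY: continuum YM on T⁴ ⇐ BetaPertH
∧ nine spine estimates (0∕9 proved); BetaPertH ⇐ (D1) ∧ (D4) ∧ CAP+tail; G-an2-4 gates asym, D1 and NE2∕3∕4.
-/

set_option autoImplicit false
set_option maxSynthPendingDepth 2

noncomputable section

namespace Summit.QuantumFields.BalabanUV.T4Continuum.NE7b.SupWhitenedHessianFourthCumulantTreeTwo

open MeasureTheory ProbabilityTheory Real Set Function Finset Matrix
open scoped BigOperators
open Literature.Probability.Distributions (matrixCLM)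
open SupFourthCumulantTree (fourth_cumulant_tree_bound)
open SupWhitenedFourthCumulantTree (second_le_of_fourth)
open SupCrossWeightedCovarianceDecay (cross_bilinear_decay)
open SupWhitenedMomentLetters (op_letter_nonneg whitened_exp_integrable whitened_second_moment_integrable)
open SupWhitenedCovarianceKernelLetter (whitenedV_hasDerivAt whitenedV_floor whitenedV_ceiling whitenedV_cross whitenedV_continuous
  whitened_integrable_lebesgue)
open SupWhitenedFirstOrderLetters (whitened_obs_lipVec whitened_cross_nonneg whitened_J_rowsum_le whitened_obs_nonneg)
open SupWhitenedFourthMoment (whitened_fourth_moment_gibbs whitened_fourth_power_integrable)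
open SupWhitenedSixthMoment (whitened_sixth_power_integrable whitened_sixth_moment_gibbs)
open SupWhitenedHessianObservableMoments (whitened_hessian_obs_fourth_moment_gibbs whitened_hessian_obs_fourth_power_integrable)
open SupWhitenedVertexMomentLetters (whitened_hessian_obs_sixth_power_integrable whitened_hessian_obs_sixth_moment_gibbs)
open SupWhitenedHessianGradientCovariance (hessian_obs_lipVec)

variable {ι κ : Type} [Fintype ι] [DecidableEq ι] [Fintype κ] [DecidableEq κ]

variable {U : EuclideanSpace ℝ ι → ℝ} {U' : EuclideanSpace ℝ ι → EuclideanSpace ℝ ι →L[ℝ] ℝ}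
  {U'' : EuclideanSpace ℝ ι → EuclideanSpace ℝ ι →L[ℝ] EuclideanSpace ℝ ι →L[ℝ] ℝ}
  {U₃ : EuclideanSpace ℝ ι → EuclideanSpace ℝ ι →L[ℝ] EuclideanSpace ℝ ι →L[ℝ] EuclideanSpace ℝ ι →L[ℝ] ℝ} {Hk : ι → ι → ℝ} {K3 : ι → ι → ι → ℝ}
  {A : Matrix ι κ ℝ} {D : κ → κ → ℝ} {γop κ₀ κ₁ κ₂ κ₃ a τ δ θp lam lamA αr αc hr γ dθ dθ' αθ βθ : ℝ} {θ : κ → κ → ℝ} {σ : ι → κ → ℝ}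
  {r : ι → ι → ℝ}

/-- **THE END — TREE DECAY OF `κ₄(F_x,G_{yz},F_t,F_s)`, GENERAL `Γ = AAᵀ`**, every moment discharged. [folklore] -/
theorem whitened_hessian_fourth_cumulant_tree_two [Nonempty κ] (hΓop : (γop • (1 : Matrix ι ι ℝ) - A * Aᵀ).PosSemidef) (Y : Finset ι)
    (hUd : ∀ φ : EuclideanSpace ℝ ι, HasFDerivAt U (U' φ) φ) (hU'd : ∀ φ : EuclideanSpace ℝ ι, HasFDerivAt U' (U'' φ) φ)
    (hU''d : ∀ φ : EuclideanSpace ℝ ι, HasFDerivAt U'' (U₃ φ) φ) (hU₃c : Continuous U₃) (hκ₀ : 0 ≤ κ₀) (hκ₁ : 0 ≤ κ₁) (ha : 0 ≤ a) (hτ : 0 < τ)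
    (hδ : 0 < δ) (hθ0 : 0 < θp) (hθ1 : θp < 1) (hκθ : (2 * κ₀ * (1 + τ) + 4 * δ) * γop ≤ θp) (hκθw : 2 * κ₀ * (1 + τ) * γop + 4 * δ ≤ θp)
    (hstab : ∀ φ : EuclideanSpace ℝ ι, -(κ₀ * ∑ x ∈ Y, φ x ^ 2) ≤ U φ)
    (hU'b : ∀ φ : EuclideanSpace ℝ ι, ‖U' φ‖ ≤ κ₁ * (a + ∑ x ∈ Y, φ x ^ 2)) (hU''b : ∀ φ : EuclideanSpace ℝ ι, ‖U'' φ‖ ≤ κ₂)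
    (hU₃b : ∀ φ : EuclideanSpace ℝ ι, ‖U₃ φ‖ ≤ κ₃) (hlam : 0 ≤ lam)
    (hUsec : ∀ s : ℝ, 0 ≤ s → s ≤ 1 → ∀ a b : EuclideanSpace ℝ ι,
      U ((1 - s) • a + s • b) - lam / 2 * (s * (1 - s)) * ∑ i, (a i - b i) ^ 2 ≤ (1 - s) * U a + s * U b)
    (hρg : lam * γop < 1)
    (hHk : ∀ (φ : EuclideanSpace ℝ ι) (x z : ι), |U'' φ (EuclideanSpace.single z (1 : ℝ)) (EuclideanSpace.single x (1 : ℝ))| ≤ Hk x z)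
    (hHk0 : ∀ v u, 0 ≤ Hk v u)
    (hK3 : ∀ (φ : EuclideanSpace ℝ ι) (u x y : ι),
      |U₃ φ (EuclideanSpace.single u (1 : ℝ)) (EuclideanSpace.single x (1 : ℝ)) (EuclideanSpace.single y (1 : ℝ))| ≤ K3 x y u)
    (hK30 : ∀ x y u, 0 ≤ K3 x y u) (ψ : EuclideanSpace ℝ ι)
    (hαr : ∀ u, ∑ w, |A u w| ≤ αr) (hαc : ∀ w, ∑ u, |A u w| ≤ αc) (hhr : ∀ v, ∑ u, Hk v u ≤ hr)
    (hlamA : ∀ x : κ, ∑ u, ∑ v, |A u x| * |A v x| * Hk v u ≤ lamA) (hlamA1 : lamA < 1) (hγ : αc * hr * αr / (1 - lamA) ≤ γ) (hγ1 : γ < 1)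
    -- the admissible `D` with weighted letters, the weights, the profiles (gradient vectors at their sites, Hessian vectors at the first site)
    (hD : ∀ x y, 0 ≤ D x y)
    (hDC : ∀ x y, (if x = y then (1 : ℝ) else 0) + ∑ z, D x z * ((if y = z then 0 else ∑ u, ∑ v, |A u y| * |A v z| * Hk v u) / (1 - lamA)) ≤ D x y)
    (hθnn : ∀ z w, 0 ≤ θ z w) (hDr : ∀ z, ∑ w, D z w * θ z w ≤ dθ) (hdθ : 0 ≤ dθ) (hDc : ∀ w, ∑ z, D z w * θ z w ≤ dθ') (hdθ' : 0 ≤ dθ')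
    (hσ0 : ∀ x w, 0 ≤ σ x w) (hσθ : ∀ x z w, σ x w ≤ σ x z * θ z w) (hr1 : ∀ x y, 1 ≤ r x y) (hrσ : ∀ x y w, r x y ^ 24 ≤ σ x w * σ y w)
    (haσ : ∀ v : ι, ∑ w, (∑ u, |A u w| * Hk v u) * σ v w ≤ αθ) (hβ : 0 ≤ βθ) (haσ' : ∀ (v : ι) (w : κ), (∑ u, |A u w| * Hk v u) * σ v w ≤ βθ)
    (hgσ : ∀ p q : ι, ∑ w, (∑ u, |A u w| * K3 p q u) * σ p w ≤ αθ) (hgσ' : ∀ (p q : ι) (w : κ), (∑ u, |A u w| * K3 p q u) * σ p w ≤ βθ)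
    (x y z t s : ι) :
    |(∫ w, (U' (matrixCLM A (WithLp.toLp 2 w) + ψ) (EuclideanSpace.single x (1 : ℝ)) - (∫ w', U' (matrixCLM A (WithLp.toLp 2 w') + ψ)
        (EuclideanSpace.single x (1 : ℝ)) ∂((volume : Measure (κ → ℝ)).tilted fun z => -(1 / 2 * (z ⬝ᵥ z) + U (matrixCLM A (WithLp.toLp 2 z) + ψ)))))
        * (U'' (matrixCLM A (WithLp.toLp 2 w) + ψ) (EuclideanSpace.single y (1 : ℝ)) (EuclideanSpace.single z (1 : ℝ)) - (∫ w', U'' (matrixCLM A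
        (WithLp.toLp 2 w') + ψ) (EuclideanSpace.single y (1 : ℝ)) (EuclideanSpace.single z (1 : ℝ)) ∂((volume : Measure (κ → ℝ)).tilted fun z => -(1
        / 2 * (z ⬝ᵥ z) + U (matrixCLM A (WithLp.toLp 2 z) + ψ))))) * (U' (matrixCLM A (WithLp.toLp 2 w) + ψ) (EuclideanSpace.single t (1 : ℝ)) - (∫
        w', U' (matrixCLM A (WithLp.toLp 2 w') + ψ) (EuclideanSpace.single t (1 : ℝ)) ∂((volume : Measure (κ → ℝ)).tilted fun z => -(1 / 2 * (z ⬝ᵥ z)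
        + U (matrixCLM A (WithLp.toLp 2 z) + ψ))))) * (U' (matrixCLM A (WithLp.toLp 2 w) + ψ) (EuclideanSpace.single s (1 : ℝ)) - (∫ w', U'
        (matrixCLM A (WithLp.toLp 2 w') + ψ) (EuclideanSpace.single s (1 : ℝ)) ∂((volume : Measure (κ → ℝ)).tilted fun z => -(1 / 2 * (z ⬝ᵥ z) + U
        (matrixCLM A (WithLp.toLp 2 z) + ψ))))) ∂((volume : Measure (κ → ℝ)).tilted fun z => -(1 / 2 * (z ⬝ᵥ z) + U (matrixCLM A (WithLp.toLp 2 z) +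
        ψ)))) - (∫ w, (U' (matrixCLM A (WithLp.toLp 2 w) + ψ) (EuclideanSpace.single x (1 : ℝ)) - (∫ w', U' (matrixCLM A (WithLp.toLp 2 w') + ψ)
        (EuclideanSpace.single x (1 : ℝ)) ∂((volume : Measure (κ → ℝ)).tilted fun z => -(1 / 2 * (z ⬝ᵥ z) + U (matrixCLM A (WithLp.toLp 2 z) + ψ)))))
        * (U'' (matrixCLM A (WithLp.toLp 2 w) + ψ) (EuclideanSpace.single y (1 : ℝ)) (EuclideanSpace.single z (1 : ℝ)) - (∫ w', U'' (matrixCLM A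
        (WithLp.toLp 2 w') + ψ) (EuclideanSpace.single y (1 : ℝ)) (EuclideanSpace.single z (1 : ℝ)) ∂((volume : Measure (κ → ℝ)).tilted fun z => -(1
        / 2 * (z ⬝ᵥ z) + U (matrixCLM A (WithLp.toLp 2 z) + ψ))))) ∂((volume : Measure (κ → ℝ)).tilted fun z => -(1 / 2 * (z ⬝ᵥ z) + U (matrixCLM A
        (WithLp.toLp 2 z) + ψ)))) * (∫ w, (U' (matrixCLM A (WithLp.toLp 2 w) + ψ) (EuclideanSpace.single t (1 : ℝ)) - (∫ w', U' (matrixCLM A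
        (WithLp.toLp 2 w') + ψ) (EuclideanSpace.single t (1 : ℝ)) ∂((volume : Measure (κ → ℝ)).tilted fun z => -(1 / 2 * (z ⬝ᵥ z) + U (matrixCLM A
        (WithLp.toLp 2 z) + ψ))))) * (U' (matrixCLM A (WithLp.toLp 2 w) + ψ) (EuclideanSpace.single s (1 : ℝ)) - (∫ w', U' (matrixCLM A (WithLp.toLp
        2 w') + ψ) (EuclideanSpace.single s (1 : ℝ)) ∂((volume : Measure (κ → ℝ)).tilted fun z => -(1 / 2 * (z ⬝ᵥ z) + U (matrixCLM A (WithLp.toLp 2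
        z) + ψ))))) ∂((volume : Measure (κ → ℝ)).tilted fun z => -(1 / 2 * (z ⬝ᵥ z) + U (matrixCLM A (WithLp.toLp 2 z) + ψ)))) - (∫ w, (U' (matrixCLM
        A (WithLp.toLp 2 w) + ψ) (EuclideanSpace.single x (1 : ℝ)) - (∫ w', U' (matrixCLM A (WithLp.toLp 2 w') + ψ) (EuclideanSpace.single x (1 : ℝ))
        ∂((volume : Measure (κ → ℝ)).tilted fun z => -(1 / 2 * (z ⬝ᵥ z) + U (matrixCLM A (WithLp.toLp 2 z) + ψ))))) * (U' (matrixCLM A (WithLp.toLp 2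
        w) + ψ) (EuclideanSpace.single t (1 : ℝ)) - (∫ w', U' (matrixCLM A (WithLp.toLp 2 w') + ψ) (EuclideanSpace.single t (1 : ℝ)) ∂((volume :
        Measure (κ → ℝ)).tilted fun z => -(1 / 2 * (z ⬝ᵥ z) + U (matrixCLM A (WithLp.toLp 2 z) + ψ))))) ∂((volume : Measure (κ → ℝ)).tilted fun z =>
        -(1 / 2 * (z ⬝ᵥ z) + U (matrixCLM A (WithLp.toLp 2 z) + ψ)))) * (∫ w, (U'' (matrixCLM A (WithLp.toLp 2 w) + ψ) (EuclideanSpace.single y (1 :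
        ℝ)) (EuclideanSpace.single z (1 : ℝ)) - (∫ w', U'' (matrixCLM A (WithLp.toLp 2 w') + ψ) (EuclideanSpace.single y (1 : ℝ))
        (EuclideanSpace.single z (1 : ℝ)) ∂((volume : Measure (κ → ℝ)).tilted fun z => -(1 / 2 * (z ⬝ᵥ z) + U (matrixCLM A (WithLp.toLp 2 z) + ψ)))))
        * (U' (matrixCLM A (WithLp.toLp 2 w) + ψ) (EuclideanSpace.single s (1 : ℝ)) - (∫ w', U' (matrixCLM A (WithLp.toLp 2 w') + ψ)
        (EuclideanSpace.single s (1 : ℝ)) ∂((volume : Measure (κ → ℝ)).tilted fun z => -(1 / 2 * (z ⬝ᵥ z) + U (matrixCLM A (WithLp.toLp 2 z) + ψ)))))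
        ∂((volume : Measure (κ → ℝ)).tilted fun z => -(1 / 2 * (z ⬝ᵥ z) + U (matrixCLM A (WithLp.toLp 2 z) + ψ)))) - (∫ w, (U' (matrixCLM A
        (WithLp.toLp 2 w) + ψ) (EuclideanSpace.single x (1 : ℝ)) - (∫ w', U' (matrixCLM A (WithLp.toLp 2 w') + ψ) (EuclideanSpace.single x (1 : ℝ))
        ∂((volume : Measure (κ → ℝ)).tilted fun z => -(1 / 2 * (z ⬝ᵥ z) + U (matrixCLM A (WithLp.toLp 2 z) + ψ))))) * (U' (matrixCLM A (WithLp.toLp 2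
        w) + ψ) (EuclideanSpace.single s (1 : ℝ)) - (∫ w', U' (matrixCLM A (WithLp.toLp 2 w') + ψ) (EuclideanSpace.single s (1 : ℝ)) ∂((volume :
        Measure (κ → ℝ)).tilted fun z => -(1 / 2 * (z ⬝ᵥ z) + U (matrixCLM A (WithLp.toLp 2 z) + ψ))))) ∂((volume : Measure (κ → ℝ)).tilted fun z =>
        -(1 / 2 * (z ⬝ᵥ z) + U (matrixCLM A (WithLp.toLp 2 z) + ψ)))) * (∫ w, (U'' (matrixCLM A (WithLp.toLp 2 w) + ψ) (EuclideanSpace.single y (1 :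
        ℝ)) (EuclideanSpace.single z (1 : ℝ)) - (∫ w', U'' (matrixCLM A (WithLp.toLp 2 w') + ψ) (EuclideanSpace.single y (1 : ℝ))
        (EuclideanSpace.single z (1 : ℝ)) ∂((volume : Measure (κ → ℝ)).tilted fun z => -(1 / 2 * (z ⬝ᵥ z) + U (matrixCLM A (WithLp.toLp 2 z) + ψ)))))
        * (U' (matrixCLM A (WithLp.toLp 2 w) + ψ) (EuclideanSpace.single t (1 : ℝ)) - (∫ w', U' (matrixCLM A (WithLp.toLp 2 w') + ψ)
        (EuclideanSpace.single t (1 : ℝ)) ∂((volume : Measure (κ → ℝ)).tilted fun z => -(1 / 2 * (z ⬝ᵥ z) + U (matrixCLM A (WithLp.toLp 2 z) + ψ)))))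
        ∂((volume : Measure (κ → ℝ)).tilted fun z => -(1 / 2 * (z ⬝ᵥ z) + U (matrixCLM A (WithLp.toLp 2 z) + ψ))))| ≤
      (4 * (αθ * dθ * (βθ * dθ') / (1 - lamA)) + 3 * (αθ * dθ * (βθ * dθ') / (1 - lamA)) ^ 2 + 4 * (5 * ((κ₂ ^ 4 + κ₃ ^ 4) * γop ^ 2) / (1 - lam *
          γop) ^ 2) + 4 * (50 * ((κ₂ ^ 6 + κ₃ ^ 6) * γop ^ 3) / (1 - lam * γop) ^ 3) + 2 * (((5 * ((κ₂ ^ 4 + κ₃ ^ 4) * γop ^ 2) / (1 - lam * γop) ^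
          2) + 1) / 2) * ((((5 * ((κ₂ ^ 4 + κ₃ ^ 4) * γop ^ 2) / (1 - lam * γop) ^ 2) + 1) / 2) + (5 * ((κ₂ ^ 4 + κ₃ ^ 4) * γop ^ 2) / (1 - lam *
          γop) ^ 2))) *
        ((r x y ^ 2)⁻¹ * (r x t ^ 2)⁻¹ * (r x s ^ 2)⁻¹ + (r x y ^ 2)⁻¹ * (r y t ^ 2)⁻¹ * (r y s ^ 2)⁻¹ + (r x t ^ 2)⁻¹ * (r y t ^ 2)⁻¹ * (r t s ^
            2)⁻¹ + (r x s ^ 2)⁻¹ * (r y s ^ 2)⁻¹ * (r t s ^ 2)⁻¹ + (r x y ^ 2)⁻¹ * (r y t ^ 2)⁻¹ * (r t s ^ 2)⁻¹ + (r x y ^ 2)⁻¹ * (r y s ^ 2)⁻¹ * (r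
            t s ^ 2)⁻¹ + (r x t ^ 2)⁻¹ * (r y t ^ 2)⁻¹ * (r y s ^ 2)⁻¹ + (r x t ^ 2)⁻¹ * (r y s ^ 2)⁻¹ * (r t s ^ 2)⁻¹ + (r x s ^ 2)⁻¹ * (r y t ^
            2)⁻¹ * (r y s ^ 2)⁻¹ + (r x s ^ 2)⁻¹ * (r y t ^ 2)⁻¹ * (r t s ^ 2)⁻¹ + (r x y ^ 2)⁻¹ * (r x t ^ 2)⁻¹ * (r t s ^ 2)⁻¹ + (r x y ^ 2)⁻¹ * (r
            x s ^ 2)⁻¹ * (r t s ^ 2)⁻¹ + (r x y ^ 2)⁻¹ * (r x t ^ 2)⁻¹ * (r y s ^ 2)⁻¹ + (r x t ^ 2)⁻¹ * (r x s ^ 2)⁻¹ * (r y s ^ 2)⁻¹ + (r x y ^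
            2)⁻¹ * (r x s ^ 2)⁻¹ * (r y t ^ 2)⁻¹ + (r x t ^ 2)⁻¹ * (r x s ^ 2)⁻¹ * (r y t ^ 2)⁻¹) := by
  haveI : Nonempty ι := ⟨x⟩
  obtain ⟨w₀⟩ := ‹Nonempty κ›
  have hUc : Continuous U := continuous_iff_continuousAt.2 fun φ => (hUd φ).continuousAt
  have hU''c : Continuous U'' := continuous_iff_continuousAt.2 fun φ => (hU''d φ).continuousAt
  have hl1 : 0 < 1 - lamA := by linarith
  have hcpos : ∀ _x : κ, 0 < 1 - lamA := fun _ => hl1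
  have hκθ₀ : 2 * κ₀ * (1 + τ) * γop ≤ θp := SupEffectiveActionDerivative.mul_opBound_le_of_le (by positivity) (by linarith) hθ0.le hκθ
  have hγop := op_letter_nonneg hΓop
  have hρ0 : 0 < 1 - lam * γop := sub_pos.2 hρg
  have hκ₂ : 0 ≤ κ₂ := (norm_nonneg (U'' ψ)).trans (hU''b ψ)
  have hκ₃ : 0 ≤ κ₃ := (norm_nonneg (U₃ ψ)).trans (hU₃b ψ)
  -- Dobrushin's plain row condition from the letters
  have hrow : ∀ x : κ, ∑ w, (if w = x then 0 else ∑ u, ∑ v, |A u w| * |A v x| * Hk v u) / (1 - lamA) ≤ γ := fun x => by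
    rw [← Finset.sum_div]
    refine le_trans (div_le_div_of_nonneg_right ?_ hl1.le) hγ
    refine le_trans (Finset.sum_le_sum fun w _ => ?_) (whitened_J_rowsum_le hHk0 hαr hαc hhr x)
    split_ifs
    · exact le_rfl
    · linarith [abs_nonneg ((1 : Matrix κ κ ℝ) x w)]
  have hγ0 : 0 ≤ γ := by
    refine le_trans (Finset.sum_nonneg fun w _ => div_nonneg ?_ hl1.le) (hrow w₀)
    split_ifs
    · exact le_rfl
    · exact whitened_cross_nonneg hHk0 A w₀ w
  have hI0 := whitened_exp_integrable hΓop Y hUc.measurable hκ₀ hτ hθ1 hκθ₀ hstab ψ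
  have hI2 := fun w => whitened_second_moment_integrable hΓop Y hUc.measurable hκ₀ hτ hδ hθ1 hκθw hstab ψ w
  have hV0 : Integrable (fun z : κ → ℝ => exp (-(1 / 2 * (z ⬝ᵥ z) + U (matrixCLM A (WithLp.toLp 2 z) + ψ)))) := by
    have h := whitened_integrable_lebesgue A ψ (k := fun _ => (1 : ℝ)) (by simpa only [mul_one] using hI0)
    simpa only [one_mul] using h
  have hV2 : ∀ w, Integrable (fun z : κ → ℝ => z w ^ 2 * exp (-(1 / 2 * (z ⬝ᵥ z) + U (matrixCLM A (WithLp.toLp 2 z) + ψ)))) := fun w => by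
    have h := whitened_integrable_lebesgue A ψ (k := fun ξ : EuclideanSpace ℝ κ => ξ w ^ 2) (hI2 w)
    simpa only [PiLp.toLp_apply] using h
  haveI : IsProbabilityMeasure ((volume : Measure (κ → ℝ)).tilted fun z => -(1 / 2 * (z ⬝ᵥ z) + U (matrixCLM A (WithLp.toLp 2 z) + ψ))) :=
      isProbabilityMeasure_tilted hV0
  have hJ : ∀ x w : κ, 0 ≤ (if w = x then (0 : ℝ) else ∑ u, ∑ v, |A u w| * |A v x| * Hk v u) := fun x w => by
    split_ifs
    · exact le_rfl
    · exact whitened_cross_nonneg hHk0 A x w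
  have hgnn : ∀ (p q : ι) (w : κ), 0 ≤ ∑ u, |A u w| * K3 p q u := fun p q w => Finset.sum_nonneg fun u _ => mul_nonneg (abs_nonneg _) (hK30 p q u)
  -- the decay of `B` ((466), with `ρ := r²⁴`) for the three kinds of pairs
  have hαθ : 0 ≤ αθ := le_trans (Finset.sum_nonneg fun w _ => mul_nonneg (whitened_obs_nonneg hHk0 A x w) (hσ0 x w)) (haσ x)
  have hK : 0 ≤ (αθ * dθ * (βθ * dθ') / (1 - lamA)) := by positivity
  have hB : ∀ v v' : ι, ∑ w, (∑ z', D z' w * ∑ u, |A u z'| * Hk v u) * (∑ z', D z' w * ∑ u, |A u z'| * Hk v' u) / (1 - lamA) ≤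
      (αθ * dθ * (βθ * dθ') / (1 - lamA)) / r v v' ^ 24 := fun v v' => by
    have h := cross_bilinear_decay (D := D) (θ := θ) (σ := σ) (ρ := fun x y => r x y ^ 24) (c := fun _ => 1 - lamA)
      (a := fun w => ∑ u, |A u w| * Hk v u) (b := fun w => ∑ u, |A u w| * Hk v' u) hD hθnn hσ0 hσθ (fun x y w => hrσ x y w)
      (fun x y => one_le_pow₀ (hr1 x y)) hDr hdθ hDc hdθ' hl1 (fun _ => le_rfl) (fun w => whitened_obs_nonneg hHk0 A v w)
      (fun w => whitened_obs_nonneg hHk0 A v' w) v v' (haσ v) hβ (haσ' v')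
    rw [div_mul_eq_div_div] at h
    exact h
  have hBgb : ∀ (p q v : ι), ∑ w, (∑ z', D z' w * ∑ u, |A u z'| * K3 p q u) * (∑ z', D z' w * ∑ u, |A u z'| * Hk v u) / (1 - lamA) ≤
      (αθ * dθ * (βθ * dθ') / (1 - lamA)) / r p v ^ 24 := fun p q v => by
    have h := cross_bilinear_decay (D := D) (θ := θ) (σ := σ) (ρ := fun x y => r x y ^ 24) (c := fun _ => 1 - lamA)
      (a := fun w => ∑ u, |A u w| * K3 p q u) (b := fun w => ∑ u, |A u w| * Hk v u) hD hθnn hσ0 hσθ (fun x y w => hrσ x y w)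
      (fun x y => one_le_pow₀ (hr1 x y)) hDr hdθ hDc hdθ' hl1 (fun _ => le_rfl) (hgnn p q) (fun w => whitened_obs_nonneg hHk0 A v w) p v (hgσ p q) hβ
      (haσ' v)
    rw [div_mul_eq_div_div] at h
    exact h
  have hBbg : ∀ (v p q : ι), ∑ w, (∑ z', D z' w * ∑ u, |A u z'| * Hk v u) * (∑ z', D z' w * ∑ u, |A u z'| * K3 p q u) / (1 - lamA) ≤
      (αθ * dθ * (βθ * dθ') / (1 - lamA)) / r v p ^ 24 := fun v p q => by
    have h := cross_bilinear_decay (D := D) (θ := θ) (σ := σ) (ρ := fun x y => r x y ^ 24) (c := fun _ => 1 - lamA)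
      (a := fun w => ∑ u, |A u w| * Hk v u) (b := fun w => ∑ u, |A u w| * K3 p q u) hD hθnn hσ0 hσθ (fun x y w => hrσ x y w)
      (fun x y => one_le_pow₀ (hr1 x y)) hDr hdθ hDc hdθ' hl1 (fun _ => le_rfl) (fun w => whitened_obs_nonneg hHk0 A v w) (hgnn p q) v p (haσ v) hβ
      (hgσ' p q)
    rw [div_mul_eq_div_div] at h
    exact h
  -- the moments under the common letters: gradients ((465), (497), (505)) and the Hessian entry ((506), (565))
  have hM4F : 5 * (κ₂ ^ 4 * γop ^ 2) / (1 - lam * γop) ^ 2 ≤ (5 * ((κ₂ ^ 4 + κ₃ ^ 4) * γop ^ 2) / (1 - lam * γop) ^ 2) :=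
    div_le_div_of_nonneg_right (by nlinarith [pow_nonneg hγop 2, pow_nonneg hκ₃ 4]) (pow_pos hρ0 2).le
  have hM4G : 5 * (κ₃ ^ 4 * γop ^ 2) / (1 - lam * γop) ^ 2 ≤ (5 * ((κ₂ ^ 4 + κ₃ ^ 4) * γop ^ 2) / (1 - lam * γop) ^ 2) :=
    div_le_div_of_nonneg_right (by nlinarith [pow_nonneg hγop 2, pow_nonneg hκ₂ 4]) (pow_pos hρ0 2).le
  have hM6F : 50 * (κ₂ ^ 6 * γop ^ 3) / (1 - lam * γop) ^ 3 ≤ (50 * ((κ₂ ^ 6 + κ₃ ^ 6) * γop ^ 3) / (1 - lam * γop) ^ 3) :=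
    div_le_div_of_nonneg_right (by nlinarith [pow_nonneg hγop 3, pow_nonneg hκ₃ 6]) (pow_pos hρ0 3).le
  have hM6G : 50 * (κ₃ ^ 6 * γop ^ 3) / (1 - lam * γop) ^ 3 ≤ (50 * ((κ₂ ^ 6 + κ₃ ^ 6) * γop ^ 3) / (1 - lam * γop) ^ 3) :=
    div_le_div_of_nonneg_right (by nlinarith [pow_nonneg hγop 3, pow_nonneg hκ₂ 6]) (pow_pos hρ0 3).le
  have h4 := fun v => (whitened_fourth_moment_gibbs hΓop Y hUd hU'd hU''c hκ₀ hκ₁ ha hτ hδ hθ0 hθ1 hκθ hstab hU'b hU''b hlam hUsec hρg ψ v).trans hM4F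
  have hI4 := fun v c => whitened_fourth_power_integrable hΓop Y hUd hU'd hκ₀ hκ₁ ha hτ hδ hθ0 hθ1 hκθ hstab hU'b ψ v c
  have hI6 := fun v c => whitened_sixth_power_integrable hΓop Y hUd hU'd hκ₀ hκ₁ ha hτ hδ hθ0 hθ1 hκθ hstab hU'b ψ v c
  have h6 := fun v => (whitened_sixth_moment_gibbs hΓop Y hUd hU'd hU''c hκ₀ hκ₁ ha hτ hδ hθ0 hθ1 hκθ hstab hU'b hU''b hlam hUsec hρg ψ v).trans hM6F
  have h2 : ∀ v : ι, ∫ w, (U' (matrixCLM A (WithLp.toLp 2 w) + ψ) (EuclideanSpace.single v (1 : ℝ)) - (∫ w', U' (matrixCLM A (WithLp.toLp 2 w') + ψ)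
      (EuclideanSpace.single v (1 : ℝ)) ∂((volume : Measure (κ → ℝ)).tilted fun z => -(1 / 2 * (z ⬝ᵥ z) + U (matrixCLM A (WithLp.toLp 2 z) + ψ))))) ^
      2 ∂((volume : Measure (κ → ℝ)).tilted fun z => -(1 / 2 * (z ⬝ᵥ z) + U (matrixCLM A (WithLp.toLp 2 z) + ψ))) ≤ (((5 * ((κ₂ ^ 4 + κ₃ ^ 4) * γop ^
      2) / (1 - lam * γop) ^ 2) + 1) / 2) := fun v => by
    refine (second_le_of_fourth (hI4 v _)).trans ?_
    have := h4 v
    linarith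
  have hG4 := fun p q => (whitened_hessian_obs_fourth_moment_gibbs hΓop Y hUd hU''d hU₃c hκ₀ hτ hθ1 hκθ₀ hstab hU''b hU₃b hlam hUsec hρg ψ p q).trans
    hM4G
  have hIG4 := fun p q c => whitened_hessian_obs_fourth_power_integrable hΓop Y hUd hU''d hκ₀ hτ hθ1 hκθ₀ hstab hU''b ψ p q c
  have hIG6 := fun p q c => whitened_hessian_obs_sixth_power_integrable hΓop Y hUd hU''d hκ₀ hτ hθ1 hκθ₀ hstab hU''b ψ p q c
  have hG6 := fun p q => (whitened_hessian_obs_sixth_moment_gibbs hΓop Y hUd hU''d hU₃c hκ₀ hτ hθ1 hκθ₀ hstab hU''b hU₃b hlam hUsec hρg ψ p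
    q).trans hM6G
  have hG2 : ∀ p q : ι, ∫ w, (U'' (matrixCLM A (WithLp.toLp 2 w) + ψ) (EuclideanSpace.single p (1 : ℝ)) (EuclideanSpace.single q (1 : ℝ)) - (∫ w',
      U'' (matrixCLM A (WithLp.toLp 2 w') + ψ) (EuclideanSpace.single p (1 : ℝ)) (EuclideanSpace.single q (1 : ℝ)) ∂((volume : Measure (κ →
      ℝ)).tilted fun z => -(1 / 2 * (z ⬝ᵥ z) + U (matrixCLM A (WithLp.toLp 2 z) + ψ))))) ^ 2 ∂((volume : Measure (κ → ℝ)).tilted fun z => -(1 / 2 *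
      (z ⬝ᵥ z) + U (matrixCLM A (WithLp.toLp 2 z) + ψ))) ≤ (((5 * ((κ₂ ^ 4 + κ₃ ^ 4) * γop ^ 2) / (1 - lam * γop) ^ 2) + 1) / 2) :=
      fun p q => by
    refine (second_le_of_fourth (hIG4 p q _)).trans ?_
    have := hG4 p q
    linarith
  -- (496) with everything written out
  exact fourth_cumulant_tree_bound
    (P := fun x F ω => (∫ s, F (update ω x s) * exp (-(1 / 2 * (update ω x s ⬝ᵥ update ω x s) + U (matrixCLM A (WithLp.toLp 2 (update ω x s)) + ψ))))
        /
      ∫ s, exp (-(1 / 2 * (update ω x s ⬝ᵥ update ω x s) + U (matrixCLM A (WithLp.toLp 2 (update ω x s)) + ψ))))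
    (V := fun z => 1 / 2 * (z ⬝ᵥ z) + U (matrixCLM A (WithLp.toLp 2 z) + ψ))
    (V₁ := fun x z => z x + U' (matrixCLM A (WithLp.toLp 2 z) + ψ) (matrixCLM A (EuclideanSpace.single x (1 : ℝ))))
    (c := fun _ => 1 - lamA) (Cw := 1 + lamA) (J := fun x w => if w = x then 0 else ∑ u, ∑ v, |A u w| * |A v x| * Hk v u) (γ := γ) (D := D)
    (F₁ := fun w => U' (matrixCLM A (WithLp.toLp 2 w) + ψ) (EuclideanSpace.single x (1 : ℝ))) (F₂ := fun w => U'' (matrixCLM A (WithLp.toLp 2 w) + ψ)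
        (EuclideanSpace.single y (1 : ℝ)) (EuclideanSpace.single z (1 : ℝ))) (F₃ := fun w => U' (matrixCLM A (WithLp.toLp 2 w) + ψ)
        (EuclideanSpace.single t (1 : ℝ))) (F₄ := fun w => U' (matrixCLM A (WithLp.toLp 2 w) + ψ) (EuclideanSpace.single s (1 : ℝ)))
    (a₁ := fun w => ∑ u, |A u w| * Hk x u) (a₂ := fun w => ∑ u, |A u w| * K3 y z u) (a₃ := fun w => ∑ u, |A u w| * Hk t u) (a₄ := fun w => ∑ u, |A u
        w| * Hk s u)
    (fun _ _ _ => rfl) (fun x z => whitenedV_hasDerivAt hUd A ψ x z) (fun x z s t => whitenedV_floor hU'd hHk A hlamA ψ x z s t) hcpos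
    (fun x z s t => whitenedV_ceiling hU'd hHk A hlamA ψ x z s t)
    (fun x w hw z s t => by rw [if_neg hw]; exact whitenedV_cross hU'd hHk A ψ x w hw z s t)
    (whitenedV_continuous hUd A ψ) hV0 hV2 hJ (fun x => by simp) hrow hγ0 hγ1 hD hDC
    (fun w z' s₁ s₂ => whitened_obs_lipVec hU'd hHk A ψ x w z' s₁ s₂) (fun w z' s₁ s₂ => hessian_obs_lipVec hU''d hK3 A ψ y z w z' s₁ s₂) (fun w z'
        s₁ s₂ => whitened_obs_lipVec hU'd hHk A ψ t w z' s₁ s₂) (fun w z' s₁ s₂ => whitened_obs_lipVec hU'd hHk A ψ s w z' s₁ s₂)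
    hK (hr1 x y) (hr1 x t) (hr1 x s) (hr1 y t) (hr1 y s) (hr1 t s)
    (hBbg x y z) (hB x t) (hB x s) (hBgb y z t) (hBgb y z s) (hB t s)
    (hI4 x _) (hI6 x _) (h2 x) (h4 x) (h6 x) (hIG4 y z _) (hIG6 y z _) (hG2 y z) (hG4 y z) (hG6 y z) (hI4 t _) (hI6 t _) (h2 t) (h4 t) (h6 t) (hI4 s
        _) (hI6 s _) (h2 s) (h4 s) (h6 s)

/-! ## Toy -/

/-- Toy (the common letters dominate: `50a ≤ 50(a+b)`, `b ≥ 0`). -/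
example (a b : ℝ) (hb : 0 ≤ b) : 50 * a ≤ 50 * (a + b) := by linarith

end Summit.QuantumFields.BalabanUV.T4Continuum.NE7b.SupWhitenedHessianFourthCumulantTreeTwo

end
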